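import Mathlib
import Summits.NavierStokesRegularity.NavierStokesRegularity.Theorems.ScenarioCensusHelicalSlabTools
import Literature.Analysis.FluidPDE.HomogeneousEulerProofs
import HarnessLib

/-!
# Census row S6 (bounded helical steady flows): the radial velocity `⟪x_h, U⟫`, its Poincaré
# inequality on one period, and the radial structure of the cut-off terms

Support file for the scenario census of `NavierStokesRegularity` (cell `pub/ns-census`, block S,
row S6 = Han–Wang–Xie, arXiv:2312.10382, Thm 1.1; tree FACT
`Literature.Analysis.FluidPDE.HanWangXie2023_helical_liouville`). In the printed Saint-Venant
estimate (§3) every cut-off term carries the factor `u · ∇φ_R = u^r φ_R'(r)`, and `u^r` is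
controlled by the Poincaré inequality (A122) on the period because its vertical means vanish.
In Cartesian vocabulary (`x_h = horizPart x`, `r u^r = ⟪x_h, U⟫`):

* `radial_contDiff`, `radial_periodic`, `fderiv_radial_eZ` — `x ↦ ⟪x_h, U x⟫` is smooth, axially
  periodic, with `∂₃⟪x_h, U⟫ = ⟪x_h, ∂₃U⟫`;
* `radial_poincare_annulus` — `∫_S χ ⟪x_h, U⟫² ≤ (L/2π)² (2r)² ∫_S χ |DU|²` on the dyadic annulus
  `χ = 𝟙{r ≤ ρ < 2r}` of one period `S`, when the vertical period means of `⟪x_h, U⟫` vanish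
  (`slab_poincare_of_verticalMean_eq_zero`);
* `cylCutoff_fderiv_apply_eq`, `abs_cylCutoff_fderiv_apply_le` — the derivative of the cylindrical
  cut-off `φ = cylCutoff r (2r)` along `U` is `a(x) ⟪x_h, U x⟫` with a smooth `z`-independent
  coefficient, and `|Dφ(x)(U x)| ≤ (C₀/r²) χ(x) |⟪x_h, U x⟫|`;
* `setIntegral_footPressure_mul_fderiv_cylCutoff_eq_zero` — `∫_S P(x_h) Dφ(x)(U x) dx = 0`
  (a `z`-independent weight against a function with zero vertical means);
* `abs_sub_footPressure_le` — `|P(x) − P(x_h)| ≤ K₃ L` on the period slab when `‖DP‖ ≤ K₃`.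

No summit statement and no census row is proved in this file.

## References

* J. Han, Y. Wang, C. Xie, arXiv:2312.10382 (2023), §3, (A122) and (A126)–(A133). [HanWangXie2023]
-/

-- the summit and its single problem share the name (D-0017 nested layout)
set_option linter.dupNamespace false

noncomputable section

open MeasureTheory Set Function Filter InnerProductSpace
open scoped Topology ENNReal NNReal RealInnerProductSpace ContDiff

namespace Summit.NavierStokesRegularity.NavierStokesRegularity.Theorems.ScenarioCensus.HelicalSlab

open Literature.Analysis Literature.Analysis.FluidPDE
open Summit.NavierStokesRegularity.NavierStokesRegularity.Theorems.ScenarioCensus.PeriodicSlab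

/-! ### The radial velocity `⟪x_h, U⟫` -/

/-- `x ↦ ⟪x_h, U x⟫` is `Cⁿ` if `U` is. -/
theorem radial_contDiff {n : WithTop ℕ∞} {U : EuclideanSpace ℝ (Fin 3) → EuclideanSpace ℝ (Fin 3)}
    (hU : ContDiff ℝ n U) : ContDiff ℝ n fun x => ⟪horizPart x, U x⟫ :=
  horizPart.contDiff.inner ℝ hU

/-- `x ↦ ⟪x_h, U x⟫` is axially periodic if `U` is. -/
theorem radial_periodic {L : ℝ} {U : EuclideanSpace ℝ (Fin 3) → EuclideanSpace ℝ (Fin 3)}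
    (hper : IsAxiallyPeriodic L U) : IsAxiallyPeriodic L fun x => ⟪horizPart x, U x⟫ := by
  intro x
  show ⟪horizPart (x + L • EuclideanSpace.single 2 (1 : ℝ)), U (x + L • EuclideanSpace.single 2 1)⟫ = _
  rw [hper x]
  have : horizPart (x + L • EuclideanSpace.single 2 (1 : ℝ)) = horizPart x := horizPart_add_smul_eZ x L
  rw [this]

/-- `∂₃⟪x_h, U⟫ = ⟪x_h, ∂₃U⟫` (the horizontal projection does not see `e₃`). -/
theorem fderiv_radial_eZ {U : EuclideanSpace ℝ (Fin 3) → EuclideanSpace ℝ (Fin 3)}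
    (hU : Differentiable ℝ U) (x : EuclideanSpace ℝ (Fin 3)) :
    fderiv ℝ (fun y => ⟪horizPart y, U y⟫) x eZ = ⟪horizPart x, fderiv ℝ U x eZ⟫ := by
  rw [fderiv_inner_apply ℝ horizPart.differentiableAt (hU x), horizPart.fderiv, horizPart_eZ,
    inner_zero_left, add_zero]

/-- Pointwise: `χ ⟪x_h, ∂₃U⟫² ≤ (2r)² χ |DU|²` on the annulus `{r ≤ ρ < 2r}` (`r ≥ 0`). -/
theorem indicator_mul_radial_deriv_sq_le {r : ℝ} (hr : 0 ≤ r)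
    {U : EuclideanSpace ℝ (Fin 3) → EuclideanSpace ℝ (Fin 3)} (x : EuclideanSpace ℝ (Fin 3)) :
    {x | r ≤ cylRadius x ∧ cylRadius x < 2 * r}.indicator (fun _ => (1 : ℝ)) x *
        ⟪horizPart x, fderiv ℝ U x eZ⟫ ^ 2 ≤
      (2 * r) ^ 2 * ({x | r ≤ cylRadius x ∧ cylRadius x < 2 * r}.indicator (fun _ => (1 : ℝ)) x *
        frobeniusNormSq (fderiv ℝ U x)) := by
  by_cases hx : x ∈ {x | r ≤ cylRadius x ∧ cylRadius x < 2 * r}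
  · rw [Set.indicator_of_mem hx, one_mul, one_mul]
    have hρ : cylRadius x < 2 * r := hx.2
    have heZ : ‖(eZ : EuclideanSpace ℝ (Fin 3))‖ = 1 := by simp [eZ]
    have h1 : |⟪horizPart x, fderiv ℝ U x eZ⟫| ≤ 2 * r * ‖fderiv ℝ U x‖ := by
      calc |⟪horizPart x, fderiv ℝ U x eZ⟫| ≤ ‖horizPart x‖ * ‖fderiv ℝ U x eZ‖ := abs_real_inner_le_norm _ _
        _ ≤ (2 * r) * (‖fderiv ℝ U x‖ * ‖(eZ : EuclideanSpace ℝ (Fin 3))‖) := by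
            rw [norm_horizPart]
            exact mul_le_mul hρ.le (ContinuousLinearMap.le_opNorm _ _) (norm_nonneg _) (by linarith)
        _ = 2 * r * ‖fderiv ℝ U x‖ := by rw [heZ, mul_one]
    have h2 : ⟪horizPart x, fderiv ℝ U x eZ⟫ ^ 2 ≤ (2 * r * ‖fderiv ℝ U x‖) ^ 2 := by
      rw [← sq_abs]; exact pow_le_pow_left₀ (abs_nonneg _) h1 2
    have h3 : ‖fderiv ℝ U x‖ ^ 2 ≤ frobeniusNormSq (fderiv ℝ U x) := sq_opNorm_le_frobeniusNormSq _
    calc ⟪horizPart x, fderiv ℝ U x eZ⟫ ^ 2 ≤ (2 * r) ^ 2 * ‖fderiv ℝ U x‖ ^ 2 := by rw [← mul_pow]; exact h2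
      _ ≤ (2 * r) ^ 2 * frobeniusNormSq (fderiv ℝ U x) := mul_le_mul_of_nonneg_left h3 (sq_nonneg _)
  · rw [Set.indicator_of_notMem hx]; simp

/-- **The Poincaré inequality for the radial velocity on a dyadic annulus of one period.** Let
`U` be smooth and axially `L`-periodic (`L > 0`), with `|DU|² ≤ B`, and suppose the vertical period
means of `⟪x_h, U⟫` vanish. Then for `r > 0`, with `χ = 𝟙{r ≤ ρ < 2r}` and `S = zSlab L 0`,
`∫_S χ ⟪x_h, U⟫² ≤ (L/2π)² (2r)² ∫_S χ |DU|²`. -/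
theorem radial_poincare_annulus {L r : ℝ} (hL : 0 < L) (hr : 0 < r)
    {U : EuclideanSpace ℝ (Fin 3) → EuclideanSpace ℝ (Fin 3)} (hU : ContDiff ℝ 1 U)
    (hper : IsAxiallyPeriodic L U) {B : ℝ} (hB : ∀ x, frobeniusNormSq (fderiv ℝ U x) ≤ B)
    (hmean : ∀ x, ∫ s in (0 : ℝ)..L, ⟪horizPart x, U (x + s • eZ)⟫ = 0) :
    ∫ x in zSlab L 0, {x | r ≤ cylRadius x ∧ cylRadius x < 2 * r}.indicator (fun _ => (1 : ℝ)) x *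
        ⟪horizPart x, U x⟫ ^ 2 ≤
      (L / (2 * Real.pi)) ^ 2 * ((2 * r) ^ 2 *
        ∫ x in zSlab L 0, {x | r ≤ cylRadius x ∧ cylRadius x < 2 * r}.indicator (fun _ => (1 : ℝ)) x *
          frobeniusNormSq (fderiv ℝ U x)) := by
  set A : Set (EuclideanSpace ℝ (Fin 3)) := {x | r ≤ cylRadius x ∧ cylRadius x < 2 * r} with hA
  set χ : EuclideanSpace ℝ (Fin 3) → ℝ := A.indicator fun _ => (1 : ℝ) with hχ
  set ur : EuclideanSpace ℝ (Fin 3) → ℝ := fun x => ⟪horizPart x, U x⟫ with hur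
  have hAm : MeasurableSet A :=
    (isClosed_le continuous_const continuous_cylRadius).measurableSet.inter
      (isOpen_lt continuous_cylRadius continuous_const).measurableSet
  have hχm : Measurable χ := measurable_const.indicator hAm
  have hχnn : ∀ x, 0 ≤ χ x := fun x => Set.indicator_nonneg (fun _ _ => zero_le_one) x
  have hχle : ∀ x, χ x ≤ 1 := fun x => Set.indicator_le_self' (fun _ _ => zero_le_one) x
  have hcyl : ∀ (x : EuclideanSpace ℝ (Fin 3)) (s : ℝ), cylRadius (x + s • eZ) = cylRadius x :=
    fun x s => by simp [cylRadius, eZ]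
  have hχz : ∀ (x : EuclideanSpace ℝ (Fin 3)) (s : ℝ), χ (x + s • eZ) = χ x := fun x s => by
    simp only [hχ, Set.indicator_apply, hA, mem_setOf_eq, hcyl]
  have hχzero : ∀ x, 2 * r ≤ cylRadius x → χ x = 0 := fun x hx => by
    simp only [hχ, Set.indicator_apply, hA, mem_setOf_eq]
    rw [if_neg]; exact fun h => absurd h.2 (not_lt.2 hx)
  have hur1 : ContDiff ℝ 1 ur := radial_contDiff hU
  have hurper : IsAxiallyPeriodic L ur := radial_periodic hper
  have hUd : Differentiable ℝ U := hU.differentiable one_ne_zero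
  have hmean' : ∀ x, ∫ s in (0 : ℝ)..L, ur (x + s • eZ) = 0 := fun x => by
    simp only [hur, horizPart_add_smul_eZ]; exact hmean x
  -- Poincaré–Wirtinger with weight `χ`
  have h1 := slab_poincare_of_verticalMean_eq_zero hL hur1 hurper hmean' hχm hχnn hχz hχle
    (ρ := 2 * r) hχzero
  -- compare `χ (∂₃ ur)²` with `(2r)² χ |DU|²`
  have hDUc : Continuous (fderiv ℝ U) := hU.continuous_fderiv one_ne_zero
  have hFc : Continuous fun x => frobeniusNormSq (fderiv ℝ U x) :=
    continuous_frobeniusNormSq_fderiv hU one_ne_zero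
  have hB0 : 0 ≤ B := (frobeniusNormSq_nonneg _).trans (hB 0)
  have hint0 : IntegrableOn (fun x => χ x * frobeniusNormSq (fderiv ℝ U x)) (zSlab L 0) volume := by
    refine integrableOn_zSlab_of_bound hL ((hχm.mul hFc.measurable).aestronglyMeasurable)
      (ρ := 2 * r) (fun x hx => by rw [hχzero x hx, zero_mul]) (B := B) fun x _ => ?_
    rw [Real.norm_eq_abs, abs_mul, abs_of_nonneg (hχnn x), abs_of_nonneg (frobeniusNormSq_nonneg _)]
    exact (mul_le_mul (hχle x) (hB x) (frobeniusNormSq_nonneg _) zero_le_one).trans (by rw [one_mul])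
  have hint : IntegrableOn (fun x => (2 * r) ^ 2 * (χ x * frobeniusNormSq (fderiv ℝ U x)))
      (zSlab L 0) volume := hint0.const_mul _
  have h2 : ∫ x in zSlab L 0, χ x * (fderiv ℝ ur x eZ) ^ 2 ≤
      ∫ x in zSlab L 0, (2 * r) ^ 2 * (χ x * frobeniusNormSq (fderiv ℝ U x)) := by
    refine integral_mono_of_nonneg (Eventually.of_forall fun x => mul_nonneg (hχnn x) (sq_nonneg _))
      hint (Eventually.of_forall fun x => ?_)
    show χ x * (fderiv ℝ ur x eZ) ^ 2 ≤ (2 * r) ^ 2 * (χ x * frobeniusNormSq (fderiv ℝ U x))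
    rw [hur, fderiv_radial_eZ hUd x]
    exact indicator_mul_radial_deriv_sq_le hr.le x
  rw [integral_const_mul] at h2
  have hπL : 0 < (2 * Real.pi / L) ^ 2 := by positivity
  have hκ : (L / (2 * Real.pi)) ^ 2 * (2 * Real.pi / L) ^ 2 = 1 := by field_simp
  calc ∫ x in zSlab L 0, χ x * ur x ^ 2
      = (L / (2 * Real.pi)) ^ 2 * ((2 * Real.pi / L) ^ 2 * ∫ x in zSlab L 0, χ x * ur x ^ 2) := by
        rw [← mul_assoc, hκ, one_mul]
    _ ≤ (L / (2 * Real.pi)) ^ 2 * ((2 * r) ^ 2 * ∫ x in zSlab L 0, χ x * frobeniusNormSq (fderiv ℝ U x)) :=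
        mul_le_mul_of_nonneg_left (h1.trans h2) (sq_nonneg _)

/-! ### The radial structure of the cut-off derivative -/

/-- **The cut-off terms are radial.** For the cylindrical cut-off `φ = cylCutoff r (2r)`
(`r > 0`) with gradient constant `C₀`: there is a smooth coefficient `a`, invariant under axial
translations and vanishing off the cylinder `{ρ < 2r}`, with `Dφ(x) v = a(x) ⟪x_h, v⟫` for all
`x, v`, and `|Dφ(x) v| ≤ (C₀/r²) χ(x) |⟪x_h, v⟫|` with `χ = 𝟙{r ≤ ρ < 2r}`. -/
theorem cylCutoff_fderiv_radial {r C₀ : ℝ} (hr : 0 < r)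
    (hC₀ : ∀ (ρ₂ ρ₁ : ℝ), 0 ≤ ρ₂ → ρ₂ < ρ₁ → ∀ x : EuclideanSpace ℝ (Fin 3),
      ‖gradient (cylCutoff ρ₂ ρ₁) x‖ ≤ C₀ / (ρ₁ - ρ₂)) :
    ∃ a : EuclideanSpace ℝ (Fin 3) → ℝ, ContDiff ℝ (⊤ : ℕ∞) a ∧
      (∀ (x : EuclideanSpace ℝ (Fin 3)) (t : ℝ), a (x + t • eZ) = a x) ∧
      (∀ x, 2 * r ≤ cylRadius x → a x = 0) ∧
      (∀ x v, fderiv ℝ (cylCutoff r (2 * r)) x v = a x * ⟪horizPart x, v⟫) ∧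
      ∀ x v, |fderiv ℝ (cylCutoff r (2 * r)) x v| ≤
        C₀ / r ^ 2 * {x | r ≤ cylRadius x ∧ cylRadius x < 2 * r}.indicator (fun _ => (1 : ℝ)) x *
          |⟪horizPart x, v⟫| := by
  obtain ⟨a, ha, haz, -, hgrad⟩ := exists_gradient_cylCutoff_eq_smul_horizPart r (2 * r)
  set φ : EuclideanSpace ℝ (Fin 3) → ℝ := cylCutoff r (2 * r) with hφ
  have hr2 : r < 2 * r := by linarith
  have hφnn : ∀ x, 0 ≤ φ x := cylCutoff_nonneg r (2 * r)
  have hφle : ∀ x, φ x ≤ 1 := cylCutoff_le_one r (2 * r)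
  have hφone : ∀ x, cylRadius x ≤ r → φ x = 1 := fun x hx => cylCutoff_eq_one hr.le hr2 hx
  have hφzero : ∀ x, 2 * r ≤ cylRadius x → φ x = 0 := fun x hx => cylCutoff_eq_zero hr.le hr2 hx
  have hDφ : ∀ x v, fderiv ℝ φ x v = a x * ⟪horizPart x, v⟫ := fun x v => by
    rw [← inner_gradient_left, hgrad x, real_inner_smul_left]
  -- `Dφ = 0` off the annulus (local extremum of the cut-off)
  have hD0 : ∀ x, x ∉ {x | r ≤ cylRadius x ∧ cylRadius x < 2 * r} → fderiv ℝ φ x = 0 := by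
    intro x hx
    simp only [mem_setOf_eq, not_and_or, not_le, not_lt] at hx
    rcases hx with hx | hx
    · have hmax : IsLocalMax φ x := Eventually.of_forall fun y => by rw [hφone x hx.le]; exact hφle y
      exact hmax.fderiv_eq_zero
    · have hmin : IsLocalMin φ x := Eventually.of_forall fun y => by rw [hφzero x hx]; exact hφnn y
      exact hmin.fderiv_eq_zero
  -- `a = 0` off the outer cylinder
  have ha0 : ∀ x, 2 * r ≤ cylRadius x → a x = 0 := by
    intro x hx
    have hg0 : gradient φ x = 0 := by
      rw [gradient, hD0 x (fun h => (not_lt.2 hx) h.2), map_zero]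
    have h1 : a x • horizPart x = 0 := by rw [← hgrad x]; exact hg0
    have hxh : horizPart x ≠ 0 := by
      intro h0
      have : cylRadius x = 0 := by rw [← norm_horizPart, h0, norm_zero]
      linarith
    exact (smul_eq_zero.1 h1).resolve_right hxh
  refine ⟨a, ha ⊤, haz, ha0, hDφ, fun x v => ?_⟩
  by_cases hx : x ∈ {x | r ≤ cylRadius x ∧ cylRadius x < 2 * r}
  · rw [Set.indicator_of_mem hx, mul_one, hDφ, abs_mul]
    refine mul_le_mul_of_nonneg_right ?_ (abs_nonneg _)
    -- `|a x| ρ = ‖∇φ x‖ ≤ C₀/r` and `ρ ≥ r`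
    have hρ : r ≤ cylRadius x := hx.1
    have hρ0 : 0 < cylRadius x := lt_of_lt_of_le hr hρ
    have h1 : |a x| * cylRadius x ≤ C₀ / r := by
      rw [← norm_smul_horizPart, ← hgrad x]
      have := hC₀ r (2 * r) hr.le hr2 x
      rwa [show 2 * r - r = r by ring] at this
    rw [le_div_iff₀ (by positivity)]
    calc |a x| * r ^ 2 = (|a x| * r) * r := by ring
      _ ≤ (|a x| * cylRadius x) * r := by
          exact mul_le_mul_of_nonneg_right (mul_le_mul_of_nonneg_left hρ (abs_nonneg _)) hr.le
      _ ≤ C₀ / r * r := mul_le_mul_of_nonneg_right h1 hr.le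
      _ = C₀ := by field_simp
  · rw [hD0 x hx, Set.indicator_of_notMem hx]; simp

/-! ### The foot-point pressure -/

/-- **Integrals of the foot-point pressure against the cut-off term vanish**: with `a` a
continuous `z`-independent coefficient vanishing off the cylinder `{ρ < 2r}` (`r > 0`), `P`
continuous, and `U` continuous axially `L`-periodic with zero vertical period means of `⟪x_h, U⟫`:
`∫_S P(x_h) a(x) ⟪x_h, U x⟫ dx = 0`. -/
theorem setIntegral_footPressure_mul_radial_eq_zero {L r : ℝ} (hL : 0 < L) (hr : 0 < r)
    {a : EuclideanSpace ℝ (Fin 3) → ℝ} (hac : Continuous a)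
    (haz : ∀ (x : EuclideanSpace ℝ (Fin 3)) (t : ℝ), a (x + t • eZ) = a x)
    (ha0 : ∀ x, 2 * r ≤ cylRadius x → a x = 0)
    {P : EuclideanSpace ℝ (Fin 3) → ℝ} (hPc : Continuous P)
    {U : EuclideanSpace ℝ (Fin 3) → EuclideanSpace ℝ (Fin 3)} (hUc : Continuous U)
    (hper : IsAxiallyPeriodic L U)
    (hmean : ∀ x, ∫ s in (0 : ℝ)..L, ⟪horizPart x, U (x + s • eZ)⟫ = 0) :
    ∫ x in zSlab L 0, (P (horizPart x) * a x) * ⟪horizPart x, U x⟫ = 0 := by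
  -- bounds for the `z`-independent weight `g = (P ∘ horizPart) a`
  obtain ⟨A₀, hA₀⟩ := (isCompact_closedBall (0 : EuclideanSpace ℝ (Fin 3)) (2 * r)).exists_bound_of_continuousOn
    hac.continuousOn
  obtain ⟨P₀, hP₀⟩ := (isCompact_closedBall (0 : EuclideanSpace ℝ (Fin 3)) (2 * r)).exists_bound_of_continuousOn
    hPc.continuousOn
  have hA₀0 : 0 ≤ A₀ := (norm_nonneg _).trans (hA₀ 0 (Metric.mem_closedBall_self (by linarith)))
  have hgm : Measurable fun x => P (horizPart x) * a x :=
    ((hPc.comp horizPart.continuous).mul hac).measurable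
  have hgz : ∀ (x : EuclideanSpace ℝ (Fin 3)) (s : ℝ),
      P (horizPart (x + s • eZ)) * a (x + s • eZ) = P (horizPart x) * a x := fun x s => by
    rw [horizPart_add_smul_eZ, haz]
  have hgG : ∀ x, |P (horizPart x) * a x| ≤ P₀ * A₀ := by
    intro x
    by_cases hx : 2 * r ≤ cylRadius x
    · rw [ha0 x hx, mul_zero, abs_zero]; exact mul_nonneg ((norm_nonneg _).trans (hP₀ 0
        (Metric.mem_closedBall_self (by linarith)))) hA₀0
    · rw [not_le] at hx
      have hmem : horizPart x ∈ Metric.closedBall (0 : EuclideanSpace ℝ (Fin 3)) (2 * r) := by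
        rw [mem_closedBall_zero_iff, norm_horizPart]; exact hx.le
      have hax : a x = a (horizPart x) := by
        conv_lhs => rw [← horizPart_add_apply_two_smul_eZ x]
        exact haz _ _
      rw [abs_mul, hax, ← Real.norm_eq_abs, ← Real.norm_eq_abs]
      exact mul_le_mul (hP₀ _ hmem) (hA₀ _ hmem) (norm_nonneg _)
        ((norm_nonneg _).trans (hP₀ _ hmem))
  have hgρ : ∀ x, 2 * r ≤ cylRadius x → P (horizPart x) * a x = 0 := fun x hx => by
    rw [ha0 x hx, mul_zero]
  have hmean' : ∀ x, ∫ s in (0 : ℝ)..L, ⟪horizPart (x + s • eZ), U (x + s • eZ)⟫ = 0 := fun x => by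
    simp only [horizPart_add_smul_eZ]; exact hmean x
  exact setIntegral_zSlab_mul_eq_zero_of_verticalMean hL hgm hgz hgG hgρ
    (horizPart.continuous.inner hUc) (radial_periodic hper) hmean'

/-- **The foot-point pressure bound on one period**: if `‖DP‖ ≤ K₃` then
`|P(x) − P(x_h)| ≤ K₃ L` for `x` in the period slab `zSlab L 0` (`x − x_h = x₂ e₃`, `0 ≤ x₂ < L`). -/
theorem abs_sub_footPressure_le {L K₃ : ℝ} {P : EuclideanSpace ℝ (Fin 3) → ℝ}
    (hPd : Differentiable ℝ P) (hK₃ : ∀ x, ‖fderiv ℝ P x‖ ≤ K₃) {x : EuclideanSpace ℝ (Fin 3)}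
    (hx : x ∈ zSlab L 0) : |P x - P (horizPart x)| ≤ K₃ * L := by
  have hK₃0 : 0 ≤ K₃ := (norm_nonneg _).trans (hK₃ 0)
  rw [mem_zSlab] at hx
  simp only [Int.cast_zero, zero_mul, zero_add, one_mul] at hx
  have h1 : ‖P x - P (horizPart x)‖ ≤ K₃ * ‖x - horizPart x‖ :=
    (convex_univ).norm_image_sub_le_of_norm_fderiv_le (fun y _ => hPd y) (fun y _ => hK₃ y)
      (mem_univ _) (mem_univ _)
  have h2 : ‖x - horizPart x‖ = |x 2| := by
    rw [horizPart_apply, sub_sub_cancel, norm_smul, Real.norm_eq_abs]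
    have : ‖(eZ : EuclideanSpace ℝ (Fin 3))‖ = 1 := by simp [eZ]
    rw [this, mul_one]
  rw [Real.norm_eq_abs, h2, abs_of_nonneg hx.1] at h1
  exact h1.trans (mul_le_mul_of_nonneg_left hx.2.le hK₃0)

end Summit.NavierStokesRegularity.NavierStokesRegularity.Theorems.ScenarioCensus.HelicalSlab

end
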